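import Summits.ResolutionOfSingularities.ResolutionOfSingularities.Theorems.FrobeniusClosingPatchingRelPerfectDepthLegalRestartCut
import Summits.ResolutionOfSingularities.ResolutionOfSingularities.Theorems.FrobeniusClosingPatchingRelPerfectDepthLegalFrozen
import Literature.AlgebraicGeometry.Resolution.EmbeddedResolutionExcellentSurfacesHistory
import Literature.AlgebraicGeometry.Resolution.AlterationsSemiStableResolution
import Literature.AlgebraicGeometry.Resolution.BirationalDimensionInequality
import Literature.AlgebraicGeometry.Resolution.ExcellentBlowup
import Literature.AlgebraicGeometry.Resolution.RegularBlowup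
import Literature.AlgebraicGeometry.Resolution.BlowupsIntegral
import HarnessLib

/-!
# Crux `PatchingRelPerfect` (stmt-ResolutionOfSingularities-16161), chain W5.2 — T6-E1b residual, the `SingCentres₃`
# discharge (RESTART loop): the SING-CENTRED PREFIX of the CJS construction (F-72), up to the first regular component

[OURS · L1 W5.2 · `SingCentres₃` discharge = RESTART AT THE FIRST REGULAR COMPONENT (res-L1-w52-plan-1 RULING R4 (3); res-type-049;
OWNER NOTE O3.1), brick R4 «prefix lemma (A)», against the tree's F-72 vocabulary (`CJSHistory.IsSigmaOMaxElimination`,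
`IsSigmaOMaxProcess`)] Fact-free (the named fact F-72 is NOT consumed here: its DERIVATIONS are analysed); NOT statements of the
manuscript under review.

THE POINT. Walk along a derivation of F-72's process (rounds of `Σ^{O,max}`-eliminations, Cor. 6.26) from a start
`(Z, X, 𝓑)` with `Z` an integral Noetherian excellent threefold and `X ⊊ Z` closed. At each blow-up step, EITHER every point of
the centre is a singular point of the current strict transform — then the step is a step of the tree's Sing-centred predicate
`IsBPermissibleSequence X (⋃ 𝓑) …` (boundary = the union of F-72's labelled family, brick R3 `iUnion_boundaryTransform_eq`) and
the bookkeeping (integral / Noetherian / excellent / dimension three / proper closed strict transform) rides along — OR some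
centre point is a REGULAR point, and then (brick R3 `exists_frozen_piece`, from Def. 6.23 (2)'s maximality and Lemma 2.31) the
stage carries a FROZEN PIECE: a non-empty closed, relatively open part of the strict transform consisting of regular points, on a
regular excellent threefold with s.n.c. boundary (F-72's per-step hypotheses) — the CUT at which the restart loop freezes and
restarts. No data is eliminated out of the `Prop`-valued derivation: the dichotomy is proved by induction on it.

* `exists_preimage_of_not_mem_support` — a blowing up hits every point off its centre;
* `round_prefix` — the dichotomy along ONE round (`IsSigmaOMaxElimination`);
* `process_prefix` — the dichotomy along the whole PROCESS (`IsSigmaOMaxProcess`), rounds concatenated by R1 `seq_trans`.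

AI-written; AI review is weaker than expert review.

## References
* V. Cossart, U. Jannsen, S. Saito, LNM 2270 (2020), Def. 6.23, Rem. 6.24, Cor. 6.26 (proof), Lemma 2.31, (6.2).
  [CossartJannsenSaito2020]
* The Stacks Project, Tags 02OS, 02ND. [StacksProject]
-/

-- `Summit.<Summit>.<Sub>.Theorems` with `Sub = Summit` (single-conjunct summit, D-0017)
set_option linter.dupNamespace false

noncomputable section

open CategoryTheory CategoryTheory.Limits AlgebraicGeometry TopologicalSpace IsLocalRing
open Literature.AlgebraicGeometry.Resolution Scheme.IdealSheafData
open Literature.AlgebraicGeometry.Resolution.CJSHistory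

namespace Summit.ResolutionOfSingularities.ResolutionOfSingularities.Theorems

universe u

namespace LegalRestart

/-! ## §1 A blowing up hits every point off its centre -/

/-- **Every point off the centre has a preimage** (the blowing up is an isomorphism over the complement of its centre).
[cite: StacksProject, Tag 02OS] -/
theorem exists_preimage_of_not_mem_support {Z' Z'' : Scheme.{u}} {τ : Z'' ⟶ Z'} {C : Z'.IdealSheafData} (hτ : IsBlowup τ C)
    {p : Z'} (hp : p ∉ (C.support : Set Z')) : ∃ q : Z'', τ q = p := by
  set W : Z'.Opens := centreCompl C with hW
  haveI : IsIso (τ ∣_ W) := hτ.isIso_compl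
  have hpW : p ∈ W := hp
  obtain ⟨u, hu⟩ := (Scheme.homeoOfIso (asIso (τ ∣_ W))).surjective ⟨p, hpW⟩
  refine ⟨u.1, ?_⟩
  have h := congrArg Subtype.val hu
  rw [Scheme.coe_homeoOfIso, asIso_hom, morphismRestrict_base_coe] at h
  exact h

/-- The centre of a step lies in the (closed) strict transform. [folklore] -/
theorem support_subset_of_hsub {Z' : Scheme.{u}} {X' : Set Z'} (hX'c : IsClosed X') {C : Z'.IdealSheafData}
    (hsub : vanishingIdeal ⟨closure X', isClosed_closure⟩ ≤ C) : (C.support : Set Z') ⊆ X' := by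
  intro y hy
  have h' : y ∈ ((vanishingIdeal (⟨closure X', isClosed_closure⟩ : Closeds Z')).support : Set Z') := support_antitone hsub hy
  rw [Scheme.IdealSheafData.coe_support_vanishingIdeal, Closeds.coe_mk, hX'c.closure_eq] at h'
  exact h'

/-! ## §2 One round -/

/-- **THE PREFIX DICHOTOMY ALONG ONE ROUND** (`IsSigmaOMaxElimination` from the round start `(Zr, Xr, 𝓑r)`, `Zr` an integral
Noetherian excellent threefold, `Xr ⊊ Zr` closed, members closed and none beyond the counter, `2 ≤ N`): either the whole round
so far is a Sing-centred `IsBPermissibleSequence Xr (⋃ 𝓑r)` with its bookkeeping, or a CUT stage with a frozen piece has been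
reached by a Sing-centred prefix. [cite: CossartJannsenSaito2020, Def. 6.23 (2)(3), Lemma 2.31] -/
theorem round_prefix {Zr : Scheme.{u}} [IsIntegral Zr] [IsNoetherian Zr] (hexcr : Scheme.IsExcellent Zr)
    (hdimr : topologicalKrullDim Zr = 3) {Xr : Set Zr} (hXr : IsClosed Xr) (hXrne : Xr ≠ Set.univ) {Br : ℕ → Set Zr} {kr : ℕ}
    (hBrcl : ∀ i, IsClosed (Br i)) (hBrk : ∀ i, kr ≤ i → Br i = ∅) {Ostart : Zr → Set ℕ} {N : ℕ} (hN : 2 ≤ N) :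
    ∀ {Z' : Scheme.{u}} {ρ : Z' ⟶ Zr} {X' : Set Z'} {B' : ℕ → Set Z'} {k' : ℕ} {O' : Z' → Set ℕ},
      IsSigmaOMaxElimination Xr Br kr Ostart N ρ X' B' k' O' →
      (IsBPermissibleSequence Xr (⋃ i, Br i) ρ X' (⋃ i, B' i) ∧ IsClosed X' ∧ (∀ i, IsClosed (B' i)) ∧
          (∀ i, k' ≤ i → B' i = ∅) ∧ IsIntegral Z' ∧ IsNoetherian Z' ∧ Scheme.IsExcellent Z' ∧
          topologicalKrullDim Z' = 3 ∧ X' ≠ Set.univ ∧ ρ '' X' ⊆ Xr) ∨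
      (∃ (Zc : Scheme.{u}) (_ : IsIntegral Zc) (_ : IsNoetherian Zc) (ρc : Zc ⟶ Zr) (Xc Bc F : Set Zc),
          IsBPermissibleSequence Xr (⋃ i, Br i) ρc Xc Bc ∧ IsClosed Xc ∧ Scheme.IsRegular Zc ∧ Scheme.IsExcellent Zc ∧
          topologicalKrullDim Zc = 3 ∧ Xc ≠ Set.univ ∧ IsStrictNormalCrossingsDivisor Zc Bc ∧ ρc '' Xc ⊆ Xr ∧
          F ⊆ Xc ∧ F.Nonempty ∧ IsClosed F ∧ (∃ O : Set Zc, IsOpen O ∧ Xc ∩ O = F) ∧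
          ∀ y ∈ F, IsRegularLocalRing
            ((Zc.presheaf.stalk y) ⧸ stalkIdeal (vanishingIdeal ⟨closure Xc, isClosed_closure⟩) y)) := by
  intro Z' ρ X' B' k' O' h
  induction h with
  | refl =>
    refine Or.inl ⟨IsBPermissibleSequence.refl, hXr, hBrcl, hBrk, inferInstance, inferInstance, hexcr, hdimr, hXrne, ?_⟩
    rintro _ ⟨x, hx, rfl⟩; exact hx
  | @blowup Z' Z'' ρ X' B' k' O' h hZreg hBsnc C τ hτ hreg hsub hperm hnc hBsing hmax ih =>
    rcases ih with ⟨hseq, hX'c, hBcl, hBk, hint, hnoeth, hexc, hdim, hXne, himg⟩ | hcut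
    swap
    · exact Or.inr hcut
    haveI := hint
    haveI := hnoeth
    have hCX : (C.support : Set Z') ⊆ X' := support_subset_of_hsub hX'c hsub
    by_cases hall : ∀ x ∈ (C.support : Set Z'), ¬ IsRegularLocalRing
        ((Z'.presheaf.stalk x) ⧸ stalkIdeal (vanishingIdeal ⟨closure X', isClosed_closure⟩) x)
    · /- CLEAN step: every centre point is singular -/
      -- the centre is not the zero ideal sheaf
      have hCne : C ≠ ⊥ := by
        intro h0
        apply hXne
        rw [Set.eq_univ_iff_forall]
        intro z
        apply hCX
        rw [h0, Scheme.IdealSheafData.support_bot]; trivial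
      haveI : IsIntegral Z'' := hτ.isIntegral hCne
      haveI : IsNoetherian Z'' := isNoetherian_of_isBlowup hτ
      have hexc'' : Scheme.IsExcellent Z'' := hτ.isExcellent hexc
      have hdim'' : topologicalKrullDim Z'' = 3 := by
        haveI := hτ.isProper
        rw [← hdim]
        exact (IsModification.of_isBlowup hτ hCne).isBirational.topologicalKrullDim_eq_of_isProper
      have hstep := IsBPermissibleSequence.blowup hseq C τ hτ hreg hsub hall hperm hnc
      rw [← iUnion_boundaryTransform_eq τ hBcl hBk] at hstep
      refine Or.inl ⟨hstep, isClosed_closure, fun i => isClosed_boundaryTransform τ B' k' C.support.isClosed i,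
        fun i hi => boundaryTransform_eq_empty_of_le τ B' k' _ hi, inferInstance, inferInstance, hexc'', hdim'', ?_, ?_⟩
      · -- the new strict transform is a proper subset
        obtain ⟨p, hp⟩ := (Set.ne_univ_iff_exists_notMem X').mp hXne
        obtain ⟨q, hq⟩ := exists_preimage_of_not_mem_support hτ (fun h' => hp (hCX h'))
        rw [Set.ne_univ_iff_exists_notMem]
        refine ⟨q, fun hq' => hp ?_⟩
        have h1 : q ∈ τ ⁻¹' X' :=
          closure_minimal (Set.preimage_mono Set.sdiff_subset) (hX'c.preimage τ.continuous) hq'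
        rw [Set.mem_preimage, hq] at h1
        exact h1
      · -- it maps into the round start
        rintro _ ⟨z, hz, rfl⟩
        have h1 : z ∈ τ ⁻¹' X' := closure_minimal (Set.preimage_mono Set.sdiff_subset) (hX'c.preimage τ.continuous) hz
        exact himg ⟨τ z, h1, by simp⟩
    · /- CUT: some centre point is a regular point -/
      push Not at hall
      obtain ⟨x, hxC, hxreg⟩ := hall
      have hx : x ∈ X' := hCX hxC
      obtain ⟨-, -, hmax3⟩ := hmax x hxC
      obtain ⟨F, hFX, hxF, hFc, hFo, hFreg⟩ := exists_frozen_piece hdim hX'c hXne hN O' ρ himg hx hxreg hmax3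
      exact Or.inr ⟨Z', hint, hnoeth, ρ, X', ⋃ i, B' i, F, hseq, hX'c, hZreg, hexc, hdim, hXne, hBsnc, himg, hFX, ⟨x, hxF⟩,
        hFc, hFo, hFreg⟩

/-! ## §3 The whole process -/

/-- **THE PREFIX DICHOTOMY ALONG THE PROCESS** (`IsSigmaOMaxProcess` from the start `(Z, X, 𝓑)`, `Z` an integral Noetherian
excellent threefold, `X ⊊ Z` closed, members closed and none beyond the counter, `2 ≤ N`): either the whole process so far is a
Sing-centred `IsBPermissibleSequence X (⋃ 𝓑)` with its bookkeeping, or a CUT stage with a frozen piece has been reached by a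
Sing-centred prefix (rounds concatenated). [cite: CossartJannsenSaito2020, Cor. 6.26 (proof), Def. 6.23] -/
theorem process_prefix {Z : Scheme.{u}} [IsIntegral Z] [IsNoetherian Z] (hexc : Scheme.IsExcellent Z)
    (hdim : topologicalKrullDim Z = 3) {X : Set Z} (hX : IsClosed X) (hXne : X ≠ Set.univ) {B : ℕ → Set Z} {k : ℕ}
    (hBcl : ∀ i, IsClosed (B i)) (hBk : ∀ i, k ≤ i → B i = ∅) {O : Z → Set ℕ} {N : ℕ} (hN : 2 ≤ N) :
    ∀ {Z' : Scheme.{u}} {σ : Z' ⟶ Z} {X' : Set Z'} {B' : ℕ → Set Z'} {k' : ℕ} {O' : Z' → Set ℕ},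
      IsSigmaOMaxProcess X B k O N σ X' B' k' O' →
      (IsBPermissibleSequence X (⋃ i, B i) σ X' (⋃ i, B' i) ∧ IsClosed X' ∧ (∀ i, IsClosed (B' i)) ∧
          (∀ i, k' ≤ i → B' i = ∅) ∧ IsIntegral Z' ∧ IsNoetherian Z' ∧ Scheme.IsExcellent Z' ∧
          topologicalKrullDim Z' = 3 ∧ X' ≠ Set.univ ∧ σ '' X' ⊆ X) ∨
      (∃ (Zc : Scheme.{u}) (_ : IsIntegral Zc) (_ : IsNoetherian Zc) (σc : Zc ⟶ Z) (Xc Bc F : Set Zc),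
          IsBPermissibleSequence X (⋃ i, B i) σc Xc Bc ∧ IsClosed Xc ∧ Scheme.IsRegular Zc ∧ Scheme.IsExcellent Zc ∧
          topologicalKrullDim Zc = 3 ∧ Xc ≠ Set.univ ∧ IsStrictNormalCrossingsDivisor Zc Bc ∧ σc '' Xc ⊆ X ∧
          F ⊆ Xc ∧ F.Nonempty ∧ IsClosed F ∧ (∃ O : Set Zc, IsOpen O ∧ Xc ∩ O = F) ∧
          ∀ y ∈ F, IsRegularLocalRing
            ((Zc.presheaf.stalk y) ⧸ stalkIdeal (vanishingIdeal ⟨closure Xc, isClosed_closure⟩) y)) := by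
  intro Z' σ X' B' k' O' h
  induction h with
  | refl =>
    refine Or.inl ⟨IsBPermissibleSequence.refl, hX, hBcl, hBk, inferInstance, inferInstance, hexc, hdim, hXne, ?_⟩
    rintro _ ⟨x, hx, rfl⟩; exact hx
  | @round Z' Z'' σ X' B' k' O' h hnot ρ X'' B'' k'' O'' hr hdone ih =>
    rcases ih with ⟨hseq, hX'c, hB'cl, hB'k, hint, hnoeth, hexc', hdim', hX'ne, himg⟩ | hcut
    swap
    · exact Or.inr hcut
    haveI := hint
    haveI := hnoeth
    rcases round_prefix hexc' hdim' hX'c hX'ne hB'cl hB'k hN hr with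
      ⟨hseqρ, hX''c, hB''cl, hB''k, hint'', hnoeth'', hexc'', hdim'', hX''ne, himg''⟩ |
      ⟨Zc, hintc, hnoethc, ρc, Xc, Bc, F, hseqc, hXcc, hZc, hexcc, hdimc, hXcne, hBc, himgc, hFX, hFne, hFc, hFo, hFreg⟩
    · refine Or.inl ⟨seq_trans hseq hseqρ, hX''c, hB''cl, hB''k, hint'', hnoeth'', hexc'', hdim'', hX''ne, ?_⟩
      rintro _ ⟨z, hz, rfl⟩
      exact himg ⟨ρ z, himg'' ⟨z, hz, rfl⟩, by simp⟩
    · refine Or.inr ⟨Zc, hintc, hnoethc, ρc ≫ σ, Xc, Bc, F, seq_trans hseq hseqc, hXcc, hZc, hexcc, hdimc, hXcne, hBc,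
        ?_, hFX, hFne, hFc, hFo, hFreg⟩
      rintro _ ⟨z, hz, rfl⟩
      exact himg ⟨ρc z, himgc ⟨z, hz, rfl⟩, by simp⟩

end LegalRestart

end Summit.ResolutionOfSingularities.ResolutionOfSingularities.Theorems

end
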